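import Literature.Probability.LatticeModels.GreenFunctionConformalRadiusProofs
import Literature.Probability.LatticeModels.LatticePotentialKernelRate
import HarnessLib

/-!
# Kozdron–Lawler 2005, Theorem 1.2 — reduction to the comparison of the logarithmic moments of
# the discrete and the continuum exit distributions (Lemma 3.4 at the origin)

Topic `Literature/Probability/LatticeModels`; third sibling of `GreenFunctionConformalRadius.lean`
(the named fact `greenFunction_origin_eq_log_conformalRadius` = Kozdron–Lawler's Theorem 1.2).
With the discrete identity (15) (`GreenFunctionConformalRadiusProofs.lean`:
`G_A(0,0) = 2 Σ_{z ∈ ∂A} H_A(0,z) a(z)`), the potential-kernel expansion (16) with its constant and a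
power rate (`LatticePotentialKernelRate.lean`: `|a(z) - (1/π) log |z| - k₀/2| ≤ C/|z|`) and the
continuum identity (11)+(17) (`GreenFunctionConformalRadiusExitLog.lean`:
`E⁰[log |B_{T_Ã}|] = -log f_A'(0)`) in the tree, the printed proof of Theorem 1.2 (§3.2) has
exactly ONE remaining input, its Lemma 3.4 at `x = 0`:

  "`|E⁰[log |B_{T_A}|] - E⁰[log |S_{τ_A}|]| ≤ c n^{-1/3} log n`"  (`A ∈ 𝒜ⁿ`),

whose printed proof rests on the Komlós–Major–Tusnády coupling (Thm. 3.1, Prop. 3.3) and the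
sharp Beurling estimates (Cor. 2.8, 2.9), none of which is in the tree. Since
`E⁰[log |S_{τ_A}|] = Σ_z H_A(0,z) log |z|` and `E⁰[log |B_{T_A}|] = -log f_A'(0)`, Lemma 3.4 at the
origin is the purely analytic statement `LogMomentComparison` below (written as the HYPOTHESIS of
a theorem — it is NOT vendored as a fact), and this file proves the bookkeeping of §3.2:

* `KozdronLawler.greenFunction_origin_of_logMomentComparison` —
  **Lemma 3.4 at the origin ⟹ Theorem 1.2** (`greenFunction_origin_eq_log_conformalRadius`), with
  the constant `2C/log 2 + (2/π)c` (`Σ_z H = 1`, `|z| ≥ n` on `∂A`, `1/n ≤ n^{-1/3} log n / log 2`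
  for `n ≥ 2`).

Nothing else is claimed; in particular Theorem 1.2 itself remains a named fact until Lemma 3.4 is
formalised. No named fact is introduced here.

## References

* M. J. Kozdron, G. F. Lawler, Electron. J. Probab. 10 (2005) 1442–1467, §3.2 (Lemma 3.4 and
  the proof of Theorem 1.2) [KozdronLawler2005].
-/

noncomputable section

open Finset
open Literature.Probability.RandomPlanarGeometry (ChordalLERW.siteGraph)

namespace Literature.Probability.LatticeModels

namespace KozdronLawler

/-- `1/n ≤ n^{-1/3} log n / log 2` for `n ≥ 2` (the `O(1/n)` terms of §3.2 are absorbed in the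
`O(n^{-1/3} log n)`). [folklore] -/
theorem inv_le_rpow_mul_log {n : ℕ} (hn : 2 ≤ n) :
    (1 : ℝ) / n ≤ (n : ℝ) ^ (-(1 : ℝ) / 3) * Real.log n / Real.log 2 := by
  have hn1 : (1 : ℝ) ≤ n := by exact_mod_cast (le_trans (by norm_num) hn)
  have hn2 : (2 : ℝ) ≤ n := by exact_mod_cast hn
  have hn0 : (0 : ℝ) < n := by linarith
  have hlog2 : 0 < Real.log 2 := Real.log_pos (by norm_num)
  have hlogn : Real.log 2 ≤ Real.log n := Real.log_le_log (by norm_num) hn2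
  have hpow : (1 : ℝ) / n ≤ (n : ℝ) ^ (-(1 : ℝ) / 3) := by
    rw [one_div, ← Real.rpow_neg_one]
    exact Real.rpow_le_rpow_of_exponent_le hn1 (by norm_num)
  rw [le_div_iff₀ hlog2]
  calc 1 / (n : ℝ) * Real.log 2 ≤ (n : ℝ) ^ (-(1 : ℝ) / 3) * Real.log 2 := by gcongr
    _ ≤ (n : ℝ) ^ (-(1 : ℝ) / 3) * Real.log n := by gcongr

/-- **Kozdron–Lawler's Theorem 1.2 from Lemma 3.4 at the origin.** If, uniformly over `A ∈ 𝒜ⁿ`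
and the Riemann maps `f` of `Ã`, the logarithmic moments of the discrete and continuum exit
distributions from `0` agree up to `O(n^{-1/3} log n)` —
`|Σ_{z ∈ ∂A} H_A(0,z) log |z| - (-log f'(0))| ≤ c n^{-1/3} log n` (Lemma 3.4 at `x = 0`, read through
`E⁰[log |S_{τ_A}|] = Σ_z H_A(0,z) log |z|` and `E⁰[log |B_{T_Ã}|] = -log f'(0)`,
`integral_log_norm_exit_squareDomain`) — then
`G_A(0) = -(2/π) log f_A'(0) + k₀ + O(n^{-1/3} log n)` (`greenFunction_origin_eq_log_conformalRadius`),
by (15) `G_A(0,0) = 2 Σ_z H_A(0,z) a(z)` and (16) `|a(z) - (1/π) log|z| - k₀/2| ≤ C/|z| ≤ C/n` on `∂A`.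
[cite: KozdronLawler2005, §3.2 (proof of Thm. 1.2)] -/
theorem greenFunction_origin_of_logMomentComparison
    (hcomparison : ∃ c : ℝ, ∀ n : ℕ, 2 ≤ n → ∀ A : Finset (Site 2), IsClass n A →
      ∀ f : ℂ → ℂ, IsUnitDiscMap A f →
        |∑ z ∈ outerBoundary (zdGraph 2) A, poissonKernel A 0 z * Real.log ‖Site.toComplex z‖ +
            Real.log ‖deriv f 0‖| ≤ c * (n : ℝ) ^ (-(1 : ℝ) / 3) * Real.log n) :
    greenFunction_origin_eq_log_conformalRadius := by
  obtain ⟨c, hc⟩ := hcomparison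
  obtain ⟨C, hC⟩ := latticePotentialKernel_two_rate
  refine ⟨2 * |C| / Real.log 2 + 2 / Real.pi * |c|, fun n hn A hA f hf => ?_⟩
  have hπ := Real.pi_pos
  have hn2 : (2 : ℝ) ≤ n := by exact_mod_cast hn
  have hn0 : (0 : ℝ) < n := by linarith
  have hlog2 : 0 < Real.log 2 := Real.log_pos (by norm_num)
  have hlogn : 0 ≤ Real.log n := Real.log_nonneg (by linarith)
  have hrate0 : 0 ≤ (n : ℝ) ^ (-(1 : ℝ) / 3) * Real.log n :=
    mul_nonneg (Real.rpow_nonneg hn0.le _) hlogn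
  have h0 : (0 : Site 2) ∈ A := hA.1
  set S := outerBoundary (zdGraph 2) A with hS
  set H : Site 2 → ℝ := fun z => poissonKernel A 0 z with hH
  set a : Site 2 → ℝ := fun z => latticePotentialKernel 2 z with ha
  set L : Site 2 → ℝ := fun z => Real.log ‖Site.toComplex z‖ with hL
  set k : ℝ := greenConst with hk
  -- (15), `Σ H = 1`, `H ≥ 0`, `|z| ≥ n` on `∂A`
  have h15 : SRW.killedGreen (ChordalLERW.siteGraph (↑A : Set (Site 2))) 0 0 = 2 * ∑ z ∈ S, H z * a z :=
    killedGreen_origin_eq_sum_poissonKernel_mul_potentialKernel A h0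
  have hSH : ∑ z ∈ S, H z = 1 := sum_poissonKernel_eq_one A h0
  have hH0 : ∀ z, 0 ≤ H z := fun z => poissonKernel_nonneg (by norm_num) A 0 z
  have hzn : ∀ z ∈ S, (n : ℝ) ≤ ‖Site.toComplex z‖ := fun z hz => norm_ge_of_mem_outerBoundary A hA hz
  -- (16) on `∂A`: `|a(z) - (1/π) L(z) - k/2| ≤ |C|/n`
  have h16 : ∀ z ∈ S, |a z - 1 / Real.pi * L z - k / 2| ≤ |C| / n := by
    intro z hz
    have hzn' := hzn z hz
    have hzpos : 0 < ‖Site.toComplex z‖ := by linarith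
    have hz0 : z ≠ 0 := by
      rintro rfl
      have : ‖Site.toComplex (0 : Site 2)‖ = 0 := by
        rw [norm_eq_zero]
        apply Complex.ext <;> simp [Site.toComplex]
      linarith
    calc |a z - 1 / Real.pi * L z - k / 2| ≤ C / ‖Site.toComplex z‖ := hC z hz0
      _ ≤ |C| / ‖Site.toComplex z‖ := by gcongr; exact le_abs_self C
      _ ≤ |C| / n := by gcongr
  -- the comparison hypothesis
  have hcmp := hc n hn A hA f hf
  -- the algebraic decomposition of §3.2
  have hlin : ∑ z ∈ S, H z * (a z - 1 / Real.pi * L z - k / 2) =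
      (∑ z ∈ S, H z * a z) - 1 / Real.pi * (∑ z ∈ S, H z * L z) - k / 2 * ∑ z ∈ S, H z := by
    rw [Finset.mul_sum, Finset.mul_sum, ← Finset.sum_sub_distrib, ← Finset.sum_sub_distrib]
    exact Finset.sum_congr rfl fun z _ => by ring
  have hdec : SRW.killedGreen (ChordalLERW.siteGraph (↑A : Set (Site 2))) 0 0 -
      (-(2 / Real.pi) * Real.log ‖deriv f 0‖ + greenConst) =
      2 * (∑ z ∈ S, H z * (a z - 1 / Real.pi * L z - k / 2)) +
        2 / Real.pi * ((∑ z ∈ S, H z * L z) + Real.log ‖deriv f 0‖) := by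
    rw [h15, hlin, hSH]
    simp only [hk]
    ring
  -- the two error terms
  have herr1 : |∑ z ∈ S, H z * (a z - 1 / Real.pi * L z - k / 2)| ≤ |C| / n := by
    calc |∑ z ∈ S, H z * (a z - 1 / Real.pi * L z - k / 2)|
        ≤ ∑ z ∈ S, |H z * (a z - 1 / Real.pi * L z - k / 2)| := Finset.abs_sum_le_sum_abs _ _
      _ ≤ ∑ z ∈ S, H z * (|C| / n) := by
          refine Finset.sum_le_sum fun z hz => ?_
          rw [abs_mul, abs_of_nonneg (hH0 z)]
          exact mul_le_mul_of_nonneg_left (h16 z hz) (hH0 z)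
      _ = |C| / n := by rw [← Finset.sum_mul, hSH, one_mul]
  have herr2 : |(∑ z ∈ S, H z * L z) + Real.log ‖deriv f 0‖| ≤ |c| * ((n : ℝ) ^ (-(1 : ℝ) / 3) * Real.log n) := by
    calc |(∑ z ∈ S, H z * L z) + Real.log ‖deriv f 0‖| ≤ c * (n : ℝ) ^ (-(1 : ℝ) / 3) * Real.log n := hcmp
      _ = c * ((n : ℝ) ^ (-(1 : ℝ) / 3) * Real.log n) := by ring
      _ ≤ |c| * ((n : ℝ) ^ (-(1 : ℝ) / 3) * Real.log n) :=
          mul_le_mul_of_nonneg_right (le_abs_self c) hrate0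
  -- `1/n ≤ n^{-1/3} log n / log 2`
  have hsmall := inv_le_rpow_mul_log hn
  rw [hdec]
  calc |2 * (∑ z ∈ S, H z * (a z - 1 / Real.pi * L z - k / 2)) +
          2 / Real.pi * ((∑ z ∈ S, H z * L z) + Real.log ‖deriv f 0‖)|
      ≤ |2 * (∑ z ∈ S, H z * (a z - 1 / Real.pi * L z - k / 2))| +
          |2 / Real.pi * ((∑ z ∈ S, H z * L z) + Real.log ‖deriv f 0‖)| := abs_add_le _ _
    _ = 2 * |∑ z ∈ S, H z * (a z - 1 / Real.pi * L z - k / 2)| +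
          2 / Real.pi * |(∑ z ∈ S, H z * L z) + Real.log ‖deriv f 0‖| := by
        rw [abs_mul, abs_mul, abs_of_pos (by norm_num : (0 : ℝ) < 2),
          abs_of_pos (by positivity : (0 : ℝ) < 2 / Real.pi)]
    _ ≤ 2 * (|C| / n) + 2 / Real.pi * (|c| * ((n : ℝ) ^ (-(1 : ℝ) / 3) * Real.log n)) := by
        gcongr
    _ = 2 * |C| * (1 / n) + 2 / Real.pi * |c| * ((n : ℝ) ^ (-(1 : ℝ) / 3) * Real.log n) := by ring
    _ ≤ 2 * |C| * ((n : ℝ) ^ (-(1 : ℝ) / 3) * Real.log n / Real.log 2) +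
          2 / Real.pi * |c| * ((n : ℝ) ^ (-(1 : ℝ) / 3) * Real.log n) := by
        gcongr
    _ = (2 * |C| / Real.log 2 + 2 / Real.pi * |c|) * (n : ℝ) ^ (-(1 : ℝ) / 3) * Real.log n := by
        field_simp

end KozdronLawler

end Literature.Probability.LatticeModels

end
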